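import Literature.Topology.FourManifolds.BandSumJunction
import Literature.Topology.FourManifolds.KirbyMovesSlideModel
import Literature.Topology.FourManifolds.LinkingNumberProofs
import Mathlib.Analysis.Convex.Contractible
import Mathlib.AlgebraicTopology.FundamentalGroupoid.SimplyConnected
import Mathlib.Topology.Subpath
import HarnessLib

/-!
# Linking numbers are additive under band sums (proof)

Topic `Literature/Topology/FourManifolds`; fact seat
`provefact-Literature.Topology.FourManifolds.Framed-8b2614fcc9` (the slide model of a handle
slide, `KirbyMovesHandleSlide.lean`). Its decomposition file `KirbyMovesSlideModel.lean` isolates,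
as the named fact (S₂) `Knot.HasLinkingNumber.bandSum`, the bilinearity of the linking number
behind the framing count of a handle slide — R. C. Kirby, *The Topology of 4-Manifolds* (1989),
Ch. I §4, p. 10: "The new framing can be computed from the linking matrix by the same process as
a change of basis … computing the new linkings". This file **proves it**, in the explicit form

* `Literature.Topology.FourManifolds.Knot.HasLinkingNumber.bandSum_of_bandData`: let `J` be a band
  sum of the disjoint oriented knots `J₁`, `J₂` along band data `b` (`BandData J₁ J₂ J avoid`,
  `BandSum.lean`), and `K` an oriented knot missing `J₁`, `J₂`, `J` and the band surface
  `b.support`; if `lk(K, J₁) = l₁` and `lk(K, J₂) = l₂` then `lk(K, J) = l₁ + l₂`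

(no regularity of the band at the four attaching points is assumed), and the discharge
`Literature.Topology.FourManifolds.Knot.HasLinkingNumber.bandSum_holds : HasLinkingNumber.bandSum`.
Everything here is proved; no named fact is introduced.

## The proof (Rolfsen, *Knots and Links* (1976), §5.D, definition (2): `lk(K, J) = [J] ∈ H₁(S³ ∖ K)`)

With `lk(K, ·)` read as the abelianised class of the loop conjugated into the base point
(`Knot.HasLinkingNumber`, `LinkingNumber.lean`), the statement is `[J] = [J₁] + [J₂]` in
`π₁(S³ ∖ K)ᵃᵇ`, and free homotopies (conjugation in the fundamental groupoid, `LoopConj` of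
`LinkingNumberWellDefined.lean`) are invisible there (`conjAb`, `LoopConj.conjAb_eq`,
`conjAbQ_conj`, `HasLinkingNumber.add_of_loops`). The geometry:

1. **The four sides of the band.** The closed lower arc `ℓ = band ∘ lowerArc` (from
   `p = band (0, -δ)` to `p' = band (1, -δ)`) and upper arc `u` (from `p'' = band (1, 1 + δ)` to
   `p''' = band (0, 1 + δ)`) lie on `J`; the left edge `e_L` (from `p` up to `p'''`) on `J₁`, the
   right edge `e_R` (from `p''` down to `p'`) on `J₂` — the latter as the left edge of the
   half-turned band (`BandData.exists_halfTurn`, `BandSumCommProofs.lean`). All four lift to the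
   parameter lines of their knots with *increasing* lifts (`BandData.exists_lift_lowerCurve`,
   `exists_lift_leftEdge` of `BandSumJunction.lean`, from the orientation clauses;
   `Knot.strictMonoOn_of_lifts` for `u`).
2. **Windows** (`Knot.exists_windows_of_lifts`, extending `Knot.apply_zero_mem_of_lifts` of
   `BandSumCommProofs.lean`): on the parameter line of `J`, after the window `[a, bb]` of `ℓ` come
   a segment mapping into `J₂` off the band, an integer translate of the window of `u`, and a
   segment mapping into `J₁` off the band, filling one period. So the loop of `J` based at `p`
   is `ℓ · P₂ · u · P₄` (`Path.Homotopic.subpath_four`, Mathlib's `Path.subpath`).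
3. **The segments ride on the summands** (`Knot.loopAt_subpath_homotopic_of_rides`): `P₂` lies
   on `J₂` and avoids the open right edge (which is inside the band surface,
   `BandData.range_left_inter_support`), so a lift of it through `J₂` is trapped in one translate
   of the complementary window (`exists_int_window_of_avoiding`, intermediate value theorem) and
   `P₂` is a reparametrisation of the complementary arc `Q₂` of `J₂` (from `p'` to `p''`);
   likewise `P₄ ≃ Q₄`, the arc of `J₁` from `p'''` to `p`; and the loops of `J₁`, `J₂` based at
   `p`, `p''` are `e_L · Q₄`, `e_R · Q₂` (`Knot.loopAt_subpath_homotopic_of_lift`). Degenerate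
   complementary arcs (a summand swallowed by its edge up to one point) are allowed throughout.
4. **Across the band** (`BandData.upper_homotopic`): `u ≃ e_R · ℓ⁻¹ · e_L` rel endpoints, because
   the band maps the open collar square together with its four corners — a star-shaped, hence
   simply connected, planar set (`cornerSquare`, `starConvex_cornerSquare`, Mathlib's
   `StarConvex.contractibleSpace`) — into `S³ ∖ K`.
5. Hence `[J] = [ℓ · Q₂ · e_R · ℓ⁻¹] · [e_L · Q₄]`, the first factor conjugate to
   `[e_R · Q₂] = [J₂]`, the second equal to `[J₁]`.

## References

* D. Rolfsen, *Knots and Links*, Publish or Perish (1976), §5.D (linking numbers, definition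
  (2)). [cite: Rolfsen1976, §5.D]
* R. C. Kirby, *The Topology of 4-Manifolds*, LNM 1374, Springer (1989), Ch. I §4, p. 10,
  Fig. 4.4. [cite: Kirby1989, Ch. I §4]
* R. E. Gompf, A. I. Stipsicz, *4-Manifolds and Kirby Calculus* (1999), §4.5, §5.1 (framing of
  a handle slide `nᵢ + nⱼ ± 2 lk`). A. Hatcher, *Algebraic Topology* (2002), §1.1 (change of base
  point; Exercise 6), Prop. 1.30 (lifting).

## Design notes

* Declares, besides theorems, the auxiliary definitions `conjAb`, `conjAbQ` (conjugation into a
  base point read in `π₁ᵃᵇ`), `cornerSquare` (with a `ContractibleSpace` instance under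
  `[Fact (0 < δ)]`), `Knot.cpt`, `Knot.loopAt` (the loop of a knot based at any parameter),
  `BandData.bandCompl`, `cornerLL/LR/UR/UL`, `rightEdgePlanar`, `lowerPath`, `upperPath`,
  `leftPath`, `rightPath`; no statement of another file is modified; nothing uses `sorry`; the
  main theorem depends only on `propext`, `Classical.choice`, `Quot.sound` and needs
  `maxHeartbeats 400000`.
-/

open scoped Manifold ContDiff Topology Real
open Function Set Metric unitInterval

noncomputable section

namespace Literature.Topology.FourManifolds

/-- Local notation: `𝔼 n` is the model Euclidean space `EuclideanSpace ℝ (Fin n)`. -/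
local notation "𝔼 " n:arg => EuclideanSpace ℝ (Fin n)

/-- Local notation: `𝕊 n` is the unit sphere in `EuclideanSpace ℝ (Fin (n + 1))`. -/
local notation "𝕊 " n:arg => (Metric.sphere (0 : EuclideanSpace ℝ (Fin (n + 1))) 1)

/-! ## Conjugation into a base point, read in the abelianised fundamental group -/

section LoopAlgebra

variable {X : Type*} [TopologicalSpace X] {x₀ y y' y₁ y₂ z : X}

/-- The class `[δ · β · δ⁻¹]ᵃᵇ ∈ π₁(X, x₀)ᵃᵇ` of a loop `β` at `y` conjugated into the base point
`x₀` along `δ` (Mathlib's inverse change of base point followed by the abelianisation map).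
[folklore] -/
def conjAb (δ : Path x₀ y) (β : Path y y) : Abelianization (FundamentalGroup X x₀) :=
  Abelianization.of ((FundamentalGroup.fundamentalGroupMulEquivOfPath δ).symm
    (FundamentalGroup.fromPath (Path.Homotopic.Quotient.mk β)))

/-- Unfolding of `conjAb`: it is the abelianised class of `δ · (β · δ⁻¹)`. [folklore] -/
theorem conjAb_def (δ : Path x₀ y) (β : Path y y) : conjAb δ β =
    Abelianization.of (FundamentalGroup.fromPath
      (Path.Homotopic.Quotient.mk (δ.trans (β.trans δ.symm)))) := rfl

/-- `conjAb` only depends on the homotopy class of the loop. [folklore] -/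
theorem conjAb_congr (δ : Path x₀ y) {β β' : Path y y} (h : β.Homotopic β') :
    conjAb δ β = conjAb δ β' := by
  unfold conjAb
  rw [Path.Homotopic.Quotient.eq.2 h]

/-- **Conjugate loops have the same class after conjugation into any base point**: if `β`
(at `y`) and `β'` (at `y'`) are conjugate in the fundamental groupoid (`LoopConj`, i.e. freely
homotopic), then `[δ β δ⁻¹]ᵃᵇ = [δ' β' δ'⁻¹]ᵃᵇ` for all `δ : x₀ ↝ y`, `δ' : x₀ ↝ y'`. Hatcher,
*Algebraic Topology* (2002), §1.1, Exercise 6. [folklore] -/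
theorem LoopConj.conjAb_eq {β : Path y y} {β' : Path y' y'} (h : LoopConj β β')
    (δ : Path x₀ y) (δ' : Path x₀ y') : conjAb δ β = conjAb δ' β' := by
  -- `β'` is conjugate to `δ' β' δ'⁻¹`
  have h' : LoopConj β' (δ'.trans (β'.trans δ'.symm)) := by
    refine ⟨δ'.symm, ?_⟩
    rw [Path.symm_symm]
  have key := (h.trans h').abelianizationOf_eq δ.symm
  rw [Path.symm_symm] at key
  rw [conjAb_def, conjAb_def]
  exact key

/-- `conjAb` is multiplicative in the loop. [folklore] -/
theorem conjAb_trans (δ : Path x₀ y) (α₁ α₂ : Path y y) :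
    conjAb δ (α₁.trans α₂) = conjAb δ α₁ * conjAb δ α₂ := by
  unfold conjAb
  rw [Path.Homotopic.Quotient.mk_trans,
    show FundamentalGroup.fromPath ((Path.Homotopic.Quotient.mk α₁).trans
        (Path.Homotopic.Quotient.mk α₂)) =
      FundamentalGroup.fromPath (Path.Homotopic.Quotient.mk α₂) *
        FundamentalGroup.fromPath (Path.Homotopic.Quotient.mk α₁) from rfl,
    map_mul, map_mul, mul_comm]

/-- **Abelian bookkeeping of a loop which is freely a product.** If the loop `β` is conjugate in
the fundamental groupoid to a product `α₁ · α₂` of loops at a common point, and `α₁`, `α₂` are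
conjugate to loops `β₁`, `β₂`, then in `π₁(X, x₀)ᵃᵇ` the class of `β` conjugated into `x₀` is the
product of the classes of `β₁` and `β₂` conjugated into `x₀`, along any connecting paths.
Hatcher (2002), §1.1 (free homotopy classes are conjugacy classes; `H₁ = π₁ᵃᵇ`). [folklore] -/
theorem conjAb_eq_mul_of_loopConj {β : Path y y} {β₁ : Path y₁ y₁} {β₂ : Path y₂ y₂}
    {α₁ α₂ : Path z z} (hβ : LoopConj β (α₁.trans α₂)) (h₁ : LoopConj α₁ β₁)
    (h₂ : LoopConj α₂ β₂) (δ : Path x₀ y) (δ₁ : Path x₀ y₁) (δ₂ : Path x₀ y₂) :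
    conjAb δ β = conjAb δ₁ β₁ * conjAb δ₂ β₂ := by
  obtain ⟨τ, hτ⟩ := id hβ
  rw [hβ.conjAb_eq δ (δ.trans τ), conjAb_trans, h₁.conjAb_eq (δ.trans τ) δ₁,
    h₂.conjAb_eq (δ.trans τ) δ₂]

end LoopAlgebra

/-! ## Windows of two disjoint arcs on a knot -/

namespace Knot

variable (K : Knot)

/-- **The windows of two disjoint, positively lifted arcs on a knot, and the two complementary
segments.** In the situation of `Knot.apply_zero_mem_of_lifts` (`BandSumCommProofs.lean`):
`ℓ`, `u` arcs on `K` on `[0, 1]` with disjoint open images, increasing lifts `φ`, `ψ`, `ℓ`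
injective on `(0, 1)`, disjoint closed sets `A ∋ u 1`, `B ∋ ℓ 1` covering the knot off the two
open arcs — an integer translate `[ψ 0 + k, ψ 1 + k]` of the window of `u` lies in the segment
`[φ 1, φ 0 + 1]` complementary to the window of `ℓ`, the piece `[φ 1, ψ 0 + k]` before it maps
into `B` and the piece `[ψ 1 + k, φ 0 + 1]` after it maps into `A`, both pieces avoiding the
two open arcs. [folklore] -/
theorem exists_windows_of_lifts {ℓ u : ℝ → 𝕊 3} {φ ψ : ℝ → ℝ} {A B : Set (𝕊 3)}
    (hφ : ContinuousOn φ (Icc 0 1)) (hψ : ContinuousOn ψ (Icc 0 1))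
    (hφℓ : ∀ s ∈ Icc (0 : ℝ) 1, K (circlePt (φ s)) = ℓ s)
    (hψu : ∀ s ∈ Icc (0 : ℝ) 1, K (circlePt (ψ s)) = u s)
    (hφm : StrictMonoOn φ (Ioo 0 1)) (hψm : StrictMonoOn ψ (Ioo 0 1))
    (hℓinj : InjOn ℓ (Ioo 0 1))
    (hA : IsClosed A) (hB : IsClosed B) (hAB : Disjoint A B)
    (hcover : ∀ t : ℝ, K (circlePt t) ∈ ℓ '' Ioo 0 1 ∪ u '' Ioo 0 1 ∪ (A ∪ B))
    (hdisj : Disjoint (ℓ '' Ioo 0 1) (u '' Ioo 0 1))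
    (hℓ1 : ℓ 1 ∈ B) (hu1 : u 1 ∈ A) :
    ∃ k : ℤ, φ 1 ≤ ψ 0 + k ∧ ψ 1 + k ≤ φ 0 + 1 ∧
      (∀ t ∈ Icc (φ 1) (ψ 0 + k), K (circlePt t) ∈ B ∧
        K (circlePt t) ∉ ℓ '' Ioo 0 1 ∧ K (circlePt t) ∉ u '' Ioo 0 1) ∧
      (∀ t ∈ Icc (ψ 1 + k) (φ 0 + 1), K (circlePt t) ∈ A ∧
        K (circlePt t) ∉ ℓ '' Ioo 0 1 ∧ K (circlePt t) ∉ u '' Ioo 0 1) := by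
  -- the parametrisation `t ↦ K (circlePt t)` has period `1`
  have hgc : Continuous fun t : ℝ ↦ K (circlePt t) := K.continuous.comp continuous_circlePt
  have hgper : ∀ (t : ℝ) (m : ℤ), K (circlePt (t + m)) = K (circlePt t) := fun t m ↦ by
    rw [circlePt_add_int]
  set a := φ 0 with ha
  set bb := φ 1 with hbb
  have hab : a < bb := strictMonoOn_Icc_of_Ioo hφ hφm ⟨le_rfl, zero_le_one⟩ ⟨zero_le_one, le_rfl⟩
    zero_lt_one
  have hba : bb ≤ a + 1 := K.lift_one_le hφ hφm hφℓ hℓinj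
  set c₀ := ψ 0 with hc₀
  set d₀ := ψ 1 with hd₀
  have hcd₀ : c₀ < d₀ := strictMonoOn_Icc_of_Ioo hψ hψm ⟨le_rfl, zero_le_one⟩ ⟨zero_le_one, le_rfl⟩
    zero_lt_one
  -- the parameter sets of the two open arcs
  set TL : Set ℝ := {t | K (circlePt t) ∈ ℓ '' Ioo 0 1} with hTL
  set TU : Set ℝ := {t | K (circlePt t) ∈ u '' Ioo 0 1} with hTU
  have hTLU : Disjoint TL TU := by
    rw [Set.disjoint_left]
    intro t ht ht'
    exact Set.disjoint_left.mp hdisj ht ht'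
  have memTL : ∀ t, t ∈ TL ↔ ∃ m : ℤ, t - m ∈ Ioo a bb := fun t ↦
    ⟨fun ht ↦ K.exists_sub_int_mem_Ioo_of_lift hφ hφm hφℓ ht, fun ⟨m, hm⟩ ↦ by
      have h := K.apply_circlePt_mem_image_of_lift hφ hφm hφℓ hm
      have e : K (circlePt (t - m)) = K (circlePt t) := by
        rw [sub_eq_add_neg, ← Int.cast_neg, hgper]
      show K (circlePt t) ∈ ℓ '' Ioo 0 1
      rwa [e] at h⟩
  have memTU : ∀ t, t ∈ TU ↔ ∃ m : ℤ, t - m ∈ Ioo c₀ d₀ := fun t ↦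
    ⟨fun ht ↦ K.exists_sub_int_mem_Ioo_of_lift hψ hψm hψu ht, fun ⟨m, hm⟩ ↦ by
      have h := K.apply_circlePt_mem_image_of_lift hψ hψm hψu hm
      have e : K (circlePt (t - m)) = K (circlePt t) := by
        rw [sub_eq_add_neg, ← Int.cast_neg, hgper]
      show K (circlePt t) ∈ u '' Ioo 0 1
      rwa [e] at h⟩
  have hTLopen : IsOpen TL := by
    have e : TL = ⋃ m : ℤ, (fun t ↦ t - (m : ℝ)) ⁻¹' Ioo a bb := by
      ext t
      simp only [Set.mem_iUnion, Set.mem_preimage]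
      exact memTL t
    rw [e]
    exact isOpen_iUnion fun m ↦ isOpen_Ioo.preimage (by fun_prop)
  -- the closed window `[c₀, d₀]` of `u` misses `TL`
  have hIcc_TL : ∀ t ∈ Icc c₀ d₀, t ∉ TL := by
    have h1 : Ioo c₀ d₀ ⊆ TLᶜ := fun t ht htL ↦
      Set.disjoint_left.mp hTLU htL ((memTU t).2 ⟨0, by simpa using ht⟩)
    have h2 : Icc c₀ d₀ ⊆ TLᶜ := by
      rw [← closure_Ioo hcd₀.ne]
      exact (hTLopen.isClosed_compl.closure_subset_iff).2 h1
    exact fun t ht ↦ h2 ht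
  have hper_TL : ∀ (t : ℝ) (m : ℤ), t + m ∈ TL ↔ t ∈ TL := fun t m ↦ by
    show K (circlePt (t + m)) ∈ ℓ '' Ioo 0 1 ↔ K (circlePt t) ∈ ℓ '' Ioo 0 1
    rw [hgper]
  -- normalise the window of `u` into the segment `[bb, a + 1]`
  set k : ℤ := ⌈bb - c₀⌉ with hk
  have hk1 : bb ≤ c₀ + k := by have := Int.le_ceil (bb - c₀); linarith
  have hk2 : c₀ + k < bb + 1 := by have := Int.ceil_lt_add_one (bb - c₀); linarith
  set c := c₀ + k with hc
  set d := d₀ + k with hd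
  have hcd : c < d := by rw [hc, hd]; linarith
  have hca : c ≤ a + 1 := by
    by_contra! hlt
    have hcTL : c ∈ TL := (memTL c).2 ⟨1, by push_cast; constructor <;> linarith⟩
    rw [hc, hper_TL] at hcTL
    exact hIcc_TL c₀ ⟨le_rfl, hcd₀.le⟩ hcTL
  have hda : d ≤ a + 1 := by
    by_contra! hlt
    set t := min d ((a + bb) / 2 + 1) with ht
    have ht1 : a + 1 < t := lt_min hlt (by linarith)
    have ht2 : t < bb + 1 := (min_le_right _ _).trans_lt (by linarith)
    have ht3 : c < t := lt_min hcd (by linarith)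
    have ht4 : t ≤ d := min_le_left _ _
    have htTL : t ∈ TL := (memTL t).2 ⟨1, by push_cast; constructor <;> linarith⟩
    have htk : t - k ∈ Icc c₀ d₀ := ⟨by rw [hc] at ht3; linarith, by rw [hd] at ht4; linarith⟩
    refine hIcc_TL _ htk ?_
    rwa [sub_eq_add_neg, ← Int.cast_neg, hper_TL]
  -- both segments avoid the parameter sets of the open arcs
  have hnotTL : ∀ t ∈ Icc bb (a + 1), t ∉ TL := fun t ht htL ↦ by
    obtain ⟨m, hm1, hm2⟩ := (memTL t).1 htL
    have hm0 : (0 : ℝ) < m := by linarith [ht.1]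
    have hm1' : (1 : ℝ) ≤ m := by exact_mod_cast (show (1 : ℤ) ≤ m by exact_mod_cast hm0)
    linarith [ht.2]
  have hnotTU₁ : ∀ t ∈ Icc bb c, t ∉ TU := fun t ht htU ↦ by
    obtain ⟨m, hm1, hm2⟩ := (memTU t).1 htU
    have hkm0 : (0 : ℝ) < k - m := by rw [hc] at ht; linarith [ht.2]
    have hkm1 : (1 : ℝ) ≤ k - m := by
      exact_mod_cast (show (1 : ℤ) ≤ k - m by exact_mod_cast hkm0)
    rw [hd] at hda
    linarith [ht.1]
  have hnotTU₂ : ∀ t ∈ Icc d (a + 1), t ∉ TU := fun t ht htU ↦ by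
    obtain ⟨m, hm1, hm2⟩ := (memTU t).1 htU
    have hmk0 : (0 : ℝ) < m - k + 1 := by rw [hd] at ht; linarith [ht.1]
    have hmk0' : (1 : ℤ) ≤ m - k + 1 := by exact_mod_cast hmk0
    have hmk1 : (m : ℝ) - k + 1 < 2 := by
      rw [hc] at hca
      have : (m : ℝ) < k + 1 := by nlinarith [ht.2, hm2, hcd₀]
      linarith
    have hmk1' : m - k + 1 < (2 : ℤ) := by exact_mod_cast hmk1
    have hmk : m = k := by omega
    subst hmk
    rw [hd] at ht
    linarith [ht.1]
  have hsegAB : ∀ t, t ∉ TL → t ∉ TU → K (circlePt t) ∈ A ∪ B := fun t h1 h2 ↦ by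
    have h := hcover t
    simp only [Set.mem_union] at h
    rcases h with (h | h) | h
    · exact absurd h h1
    · exact absurd h h2
    · exact h
  -- a connected segment mapping into `A ∪ B` lies in `A` or in `B`
  have hconn : ∀ (x y : ℝ), (∀ t ∈ Icc x y, K (circlePt t) ∈ A ∪ B) →
      Icc x y ⊆ (fun t ↦ K (circlePt t)) ⁻¹' A ∨ Icc x y ⊆ (fun t ↦ K (circlePt t)) ⁻¹' B :=
    fun x y hxy ↦ (isPreconnected_iff_subset_of_disjoint_closed.1
      (isPreconnected_Icc (a := x) (b := y))) _ _ (hA.preimage hgc) (hB.preimage hgc)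
      (fun t ht ↦ hxy t ht) (by
        ext t
        simp only [Set.mem_inter_iff, Set.mem_preimage, Set.mem_empty_iff_false, iff_false,
          not_and]
        exact fun _ htA htB ↦ Set.disjoint_left.mp hAB htA htB)
  have hbc : bb ≤ c := hk1
  refine ⟨k, hbc, hda, fun t ht ↦ ?_, fun t ht ↦ ?_⟩
  · have h1 : t ∉ TL := hnotTL t ⟨ht.1, ht.2.trans hca⟩
    have h2 : t ∉ TU := hnotTU₁ t ht
    refine ⟨?_, h1, h2⟩
    have hbbB : K (circlePt bb) ∈ B := by rw [hbb, hφℓ 1 ⟨zero_le_one, le_rfl⟩]; exact hℓ1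
    rcases hconn bb c (fun t ht ↦ hsegAB t (hnotTL t ⟨ht.1, ht.2.trans hca⟩) (hnotTU₁ t ht))
      with h | h
    · exact absurd (h ⟨le_rfl, hbc⟩) (Set.disjoint_right.mp hAB hbbB)
    · exact h ht
  · have h1 : t ∉ TL := hnotTL t ⟨(hbc.trans hcd.le).trans ht.1, ht.2⟩
    have h2 : t ∉ TU := hnotTU₂ t ht
    refine ⟨?_, h1, h2⟩
    have hdA : K (circlePt d) ∈ A := by
      rw [hd, hgper, hd₀, hψu 1 ⟨zero_le_one, le_rfl⟩]; exact hu1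
    rcases hconn d (a + 1) (fun t ht ↦ hsegAB t
      (hnotTL t ⟨(hbc.trans hcd.le).trans ht.1, ht.2⟩) (hnotTU₂ t ht)) with h | h
    · exact h ht
    · exact absurd (h ⟨le_rfl, hda⟩) (Set.disjoint_left.mp hAB hdA)

end Knot


/-! ## A lift trapped between two windows -/

/-- **A lift avoiding the translates of an open window is trapped in one complementary closed
window.** Let `ρ` be continuous on `[0, 1]` with no value congruent modulo `1` to a point of
`(a, b)` (`a < b ≤ a + 1`), starting at a translate of `b` and ending at a translate of `a`. Then
for one integer `m`, `ρ` maps `[0, 1]` into `[b + m, a + 1 + m]`, with `ρ 0 = b + m` and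
`ρ 1 = a + 1 + m` (intermediate value theorem). [folklore] -/
theorem exists_int_window_of_avoiding {ρ : ℝ → ℝ} (hρ : ContinuousOn ρ (Icc 0 1)) {a b : ℝ}
    (hab : a < b) (hba : b ≤ a + 1)
    (havoid : ∀ r ∈ Icc (0 : ℝ) 1, ∀ m : ℤ, ρ r - m ∉ Ioo a b)
    (h0 : ∃ m : ℤ, ρ 0 = b + m) (h1 : ∃ m : ℤ, ρ 1 = a + m) :
    ∃ m : ℤ, (∀ r ∈ Icc (0 : ℝ) 1, ρ r ∈ Icc (b + m) (a + 1 + m)) ∧ ρ 0 = b + m ∧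
      ρ 1 = a + 1 + m := by
  obtain ⟨m, hm⟩ := h0
  have hupper : ∀ r ∈ Icc (0 : ℝ) 1, ρ r ≤ a + 1 + m := by
    intro r hr
    by_contra! hlt
    -- a value in the gap `(a + 1 + m, b + 1 + m)` is attained on `[0, r]`
    set v := (a + 1 + m + min (ρ r) (b + 1 + m)) / 2 with hv
    have hv1 : a + 1 + m < v := by
      rw [hv]
      have : a + 1 + m < min (ρ r) (b + 1 + m) := lt_min hlt (by linarith)
      linarith
    have hv2 : v < b + 1 + m := by
      rw [hv]
      have : min (ρ r) (b + 1 + m) ≤ b + 1 + m := min_le_right _ _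
      linarith
    have hv3 : v ≤ ρ r := by
      rw [hv]
      have : min (ρ r) (b + 1 + m) ≤ ρ r := min_le_left _ _
      linarith
    have hv0 : ρ 0 ≤ v := by rw [hm]; linarith
    have hivt := intermediate_value_Icc hr.1 (hρ.mono (Icc_subset_Icc_right hr.2))
    obtain ⟨r', hr', hρr'⟩ := hivt ⟨hv0, hv3⟩
    have hr'1 : r' ∈ Icc (0 : ℝ) 1 := ⟨hr'.1, hr'.2.trans hr.2⟩
    refine havoid r' hr'1 (m + 1) ⟨?_, ?_⟩
    · rw [hρr']; push_cast; linarith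
    · rw [hρr']; push_cast; linarith
  have hlower : ∀ r ∈ Icc (0 : ℝ) 1, b + m ≤ ρ r := by
    intro r hr
    by_contra! hlt
    set v := (b + m + max (ρ r) (a + m)) / 2 with hv
    have hv1 : v < b + m := by
      rw [hv]
      have : max (ρ r) (a + m) < b + m := max_lt hlt (by linarith)
      linarith
    have hv2 : a + m < v := by
      rw [hv]
      have : a + m ≤ max (ρ r) (a + m) := le_max_right _ _
      linarith
    have hv3 : ρ r ≤ v := by
      rw [hv]
      have : ρ r ≤ max (ρ r) (a + m) := le_max_left _ _
      linarith
    have hv0 : v ≤ ρ 0 := by rw [hm]; linarith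
    have hivt := intermediate_value_Icc' hr.1 (hρ.mono (Icc_subset_Icc_right hr.2))
    obtain ⟨r', hr', hρr'⟩ := hivt ⟨hv3, hv0⟩
    have hr'1 : r' ∈ Icc (0 : ℝ) 1 := ⟨hr'.1, hr'.2.trans hr.2⟩
    refine havoid r' hr'1 m ⟨?_, ?_⟩
    · rw [hρr']; linarith
    · rw [hρr']; linarith
  refine ⟨m, fun r hr ↦ ⟨hlower r hr, hupper r hr⟩, hm, ?_⟩
  obtain ⟨m₁, hm₁⟩ := h1
  have hle := hupper 1 ⟨zero_le_one, le_rfl⟩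
  have hge := hlower 1 ⟨zero_le_one, le_rfl⟩
  rw [hm₁] at hle hge ⊢
  have h1' : (m₁ : ℝ) ≤ 1 + m := by linarith
  have h2' : (m : ℝ) < m₁ := by linarith
  have h1'' : m₁ ≤ 1 + m := by exact_mod_cast h1'
  have h2'' : m < m₁ := by exact_mod_cast h2'
  have : m₁ = m + 1 := by omega
  rw [this]; push_cast; ring

/-! ## The parameter square with its four corners: a simply connected planar set missing `K` -/

/-- **The open collar square together with the four attaching corners**
`(0, -δ)`, `(1, -δ)`, `(1, 1 + δ)`, `(0, 1 + δ)` — the part of the parameter plane of a band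
which the band map sends into the complement of any knot missing the band surface and the two
summands. It is star-shaped about the centre of the square. [folklore] -/
def cornerSquare (δ : ℝ) : Set (𝔼 2) :=
  squareNhd δ ∪ {pt2 0 (-δ), pt2 1 (-δ), pt2 1 (1 + δ), pt2 0 (1 + δ)}

/-- The open collar square lies in `cornerSquare δ`. [folklore] -/
theorem squareNhd_subset_cornerSquare (δ : ℝ) : squareNhd δ ⊆ cornerSquare δ :=
  subset_union_left

/-- The coordinates of `pt2 a c` lie in an interval containing `a` and `c`. [folklore] -/
theorem pt2_apply_mem_Icc {lo hi a c : ℝ} (ha : a ∈ Icc lo hi) (hc : c ∈ Icc lo hi) (i : Fin 2) :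
    (pt2 a c) i ∈ Icc lo hi := by
  fin_cases i
  · exact ha
  · exact hc

/-- Coordinates of points of `cornerSquare δ` lie in `[-δ, 1 + δ]`. [folklore] -/
theorem apply_mem_Icc_of_mem_cornerSquare {δ : ℝ} (hδ : 0 < δ) {x : 𝔼 2}
    (hx : x ∈ cornerSquare δ) (i : Fin 2) : x i ∈ Icc (-δ) (1 + δ) := by
  rcases hx with hx | hx
  · exact Ioo_subset_Icc_self (hx i)
  · simp only [mem_insert_iff, mem_singleton_iff] at hx
    have h0 : (0 : ℝ) ∈ Icc (-δ) (1 + δ) := ⟨by linarith, by linarith⟩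
    have h1 : (1 : ℝ) ∈ Icc (-δ) (1 + δ) := ⟨by linarith, by linarith⟩
    have hm : (-δ : ℝ) ∈ Icc (-δ) (1 + δ) := ⟨le_rfl, by linarith⟩
    have hp : (1 + δ : ℝ) ∈ Icc (-δ) (1 + δ) := ⟨by linarith, le_rfl⟩
    rcases hx with rfl | rfl | rfl | rfl
    exacts [pt2_apply_mem_Icc h0 hm i, pt2_apply_mem_Icc h1 hm i, pt2_apply_mem_Icc h1 hp i,
      pt2_apply_mem_Icc h0 hp i]

/-- **`cornerSquare δ` is star-shaped about the centre `(1/2, 1/2)`**: the open segment from the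
centre to any of its points lies in the open collar square. [folklore] -/
theorem starConvex_cornerSquare {δ : ℝ} (hδ : 0 < δ) :
    StarConvex ℝ (pt2 2⁻¹ 2⁻¹) (cornerSquare δ) := by
  intro y hy a c ha hc hac
  rcases hc.eq_or_lt with rfl | hc0
  · -- `c = 0`: the centre
    rw [add_zero] at hac
    subst hac
    rw [one_smul, zero_smul, add_zero]
    refine squareNhd_subset_cornerSquare δ (Fin.forall_fin_two.2 ⟨?_, ?_⟩)
    · rw [pt2_apply_zero]; constructor <;> linarith
    · rw [pt2_apply_one]; constructor <;> linarith
  by_cases hc1 : c = 1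
  · subst hc1
    have ha0 : a = 0 := by linarith
    subst ha0
    rwa [zero_smul, one_smul, zero_add]
  -- `0 < c < 1`: the point is in the open square
  have hc1' : c < 1 := lt_of_le_of_ne (by linarith) hc1
  have ha0 : 0 < a := by linarith
  refine squareNhd_subset_cornerSquare δ fun i ↦ ?_
  have hyi := apply_mem_Icc_of_mem_cornerSquare hδ hy i
  have e : (a • pt2 (2⁻¹ : ℝ) 2⁻¹ + c • y) i = a * 2⁻¹ + c * y i := by
    fin_cases i <;> simp [pt2]
  rw [e]
  constructor <;> nlinarith [hyi.1, hyi.2]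

/-- `cornerSquare δ` is contractible, hence simply connected (a nonempty star-shaped set).
[folklore] -/
instance contractibleSpace_cornerSquare {δ : ℝ} [Fact (0 < δ)] :
    ContractibleSpace (cornerSquare δ) :=
  (starConvex_cornerSquare (Fact.out : 0 < δ)).contractibleSpace
    ⟨pt2 0 (-δ), Or.inr (by simp)⟩

/-! ## Generic path lemmas -/

section PathLemmas

variable {Y : Type*} [TopologicalSpace Y] {x y w : Y}

/-- A path is homotopic to any of its reparametrisations, pointwise form (Mathlib's
`Path.Homotopy.reparam`). [folklore] -/
theorem Path.Homotopic.of_reparam_eq {γ γ' : Path x y} (g : I → I) (hg : Continuous g)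
    (h0 : g 0 = 0) (h1 : g 1 = 1) (heq : ∀ s, γ' s = γ (g s)) : γ.Homotopic γ' := by
  have : γ' = γ.reparam g hg h0 h1 := by
    ext s
    rw [Path.coe_reparam]
    exact heq s
  rw [this]
  exact ⟨Path.Homotopy.reparam γ g hg h0 h1⟩

/-- **A path is homotopic to the concatenation of four consecutive subpaths.** [folklore] -/
theorem Path.Homotopic.subpath_four (γ : Path x y) (T₁ T₂ T₃ : I) :
    ((((γ.subpath 0 T₁).trans (γ.subpath T₁ T₂)).trans (γ.subpath T₂ T₃)).trans
      (γ.subpath T₃ 1)).Homotopic (γ.cast γ.source γ.target) := by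
  have h1 : ((γ.subpath 0 T₁).trans (γ.subpath T₁ T₂)).Homotopic (γ.subpath 0 T₂) :=
    ⟨Path.Homotopy.subpathTransSubpath γ 0 T₁ T₂⟩
  have h2 : ((γ.subpath 0 T₂).trans (γ.subpath T₂ T₃)).Homotopic (γ.subpath 0 T₃) :=
    ⟨Path.Homotopy.subpathTransSubpath γ 0 T₂ T₃⟩
  have h3 : ((γ.subpath 0 T₃).trans (γ.subpath T₃ 1)).Homotopic (γ.subpath 0 1) :=
    ⟨Path.Homotopy.subpathTransSubpath γ 0 T₃ 1⟩
  rw [← Path.subpath_zero_one]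
  exact (((h1.hcomp (Path.Homotopic.refl _)).trans h2).hcomp (Path.Homotopic.refl _)).trans h3

/-- **A path is homotopic to the concatenation of two consecutive subpaths.** [folklore] -/
theorem Path.Homotopic.subpath_two (γ : Path x y) (T : I) :
    ((γ.subpath 0 T).trans (γ.subpath T 1)).Homotopic (γ.cast γ.source γ.target) := by
  rw [← Path.subpath_zero_one]
  exact ⟨Path.Homotopy.subpathTransSubpath γ 0 T 1⟩

/-- Casts commute with concatenation. [folklore] -/
theorem Path.cast_trans_cast (p : Path x y) (q : Path y w) {x' y' w' : Y} (hx : x' = x)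
    (hy : y' = y) (hw : w' = w) :
    (p.cast hx hy).trans (q.cast hy hw) = (p.trans q).cast hx hw := by
  ext t
  rfl

/-- Casts commute with reversal. [folklore] -/
theorem Path.symm_cast' (p : Path x y) {x' y' : Y} (hx : x' = x) (hy : y' = y) :
    (p.cast hx hy).symm = p.symm.cast hy hx := by
  ext t
  rfl

/-- A cast of a cast is a cast. [folklore] -/
theorem Path.cast_cast' (p : Path x y) {x' y' x'' y'' : Y} (hx : x' = x) (hy : y' = y)
    (hx' : x'' = x') (hy' : y'' = y') :
    (p.cast hx hy).cast hx' hy' = p.cast (hx'.trans hx) (hy'.trans hy) := by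
  ext t
  rfl

/-- A cast along reflexive equalities is the path itself. [folklore] -/
theorem Path.cast_rfl_rfl' (p : Path x y) : p.cast rfl rfl = p := by
  ext t
  rfl

end PathLemmas

/-! ## Loops of a knot in a knot complement, based at any parameter -/

namespace Knot

variable (K : Knot)

/-- The point `J (circlePt θ)` of the knot `J`, disjoint from `K`, as a point of `S³ ∖ K`.
[folklore] -/
def cpt {J : Knot} (h : Disjoint (range ⇑K) (range ⇑J)) (θ : ℝ) : K.complement :=
  ⟨J (circlePt θ), mem_complement_of_disjoint h _⟩

/-- Unfolding of `cpt`. [folklore] -/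
@[simp] theorem coe_cpt {J : Knot} (h : Disjoint (range ⇑K) (range ⇑J)) (θ : ℝ) :
    (K.cpt h θ : 𝕊 3) = J (circlePt θ) := rfl

/-- **The loop of `J` in `S³ ∖ K` based at the parameter `θ₀`**: `t ↦ J (circlePt (θ₀ + t))`.
[folklore] -/
def loopAt {J : Knot} (h : Disjoint (range ⇑K) (range ⇑J)) (θ₀ : ℝ) :
    Path (K.cpt h θ₀) (K.cpt h θ₀) where
  toFun t := K.cpt h (θ₀ + t)
  continuous_toFun := by
    refine Continuous.subtype_mk ?_ _
    exact J.continuous.comp (continuous_circlePt.comp (continuous_const.add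
      continuous_subtype_val))
  source' := by
    apply Subtype.ext
    simp
  target' := by
    apply Subtype.ext
    change J (circlePt (θ₀ + 1)) = J (circlePt θ₀)
    rw [circlePt_add_one]

/-- Values of `loopAt`. [folklore] -/
@[simp] theorem coe_loopAt_apply {J : Knot} (h : Disjoint (range ⇑K) (range ⇑J)) (θ₀ : ℝ)
    (t : I) : ((K.loopAt h θ₀ t : K.complement) : 𝕊 3) = J (circlePt (θ₀ + t)) := rfl

/-- Values of subpaths of `loopAt`. [folklore] -/
theorem coe_loopAt_subpath_apply {J : Knot} (h : Disjoint (range ⇑K) (range ⇑J)) (θ₀ : ℝ)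
    (T T' r : I) : (((K.loopAt h θ₀).subpath T T' r : K.complement) : 𝕊 3) =
      J (circlePt (θ₀ + ((1 - r) * T + r * T'))) := rfl

/-- **The loop of `J` based at any parameter is conjugate to its loop based at `J (1, 0)`**
(`Knot.loopInCompl`): rotating the base point along the knot (`LoopConj.of_square` with the
square `(s, t) ↦ J (circlePt (s θ₀ + t))`). [folklore] -/
theorem loopConj_loopInCompl_loopAt {J : Knot} (h : Disjoint (range ⇑K) (range ⇑J)) (θ₀ : ℝ) :
    LoopConj (K.loopInCompl J h) (K.loopAt h θ₀) := by
  let F : C(I × I, K.complement) :=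
    ⟨fun q ↦ K.cpt h (q.1 * θ₀ + q.2), by
      refine Continuous.subtype_mk ?_ _
      exact J.continuous.comp (continuous_circlePt.comp
        ((continuous_subtype_val.comp continuous_fst).mul continuous_const |>.add
          (continuous_subtype_val.comp continuous_snd)))⟩
  refine LoopConj.of_square F (fun s' ↦ ?_) _ _ (fun t ↦ ?_) (fun t ↦ ?_)
  · apply Subtype.ext
    change J (circlePt (s' * θ₀ + 0)) = J (circlePt (s' * θ₀ + 1))
    rw [add_zero, circlePt_add_one]
  · apply Subtype.ext
    change J (circlePoint (2 * π * t)) = J (circlePt (0 * θ₀ + t))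
    rw [zero_mul, zero_add, circlePt_eq_circlePoint]
  · apply Subtype.ext
    change J (circlePt (θ₀ + t)) = J (circlePt (1 * θ₀ + t))
    rw [one_mul]

/-- **A subpath of the loop of `J` against an external parametrisation of the same arc by a
lift**: if `ξ` is a path in `S³ ∖ K` with `ξ s = J (circlePt (φ s))` for a continuous monotone
`φ` with `φ 0 = θ₀ + T < φ 1 = θ₀ + T'`, then the subpath of `loopAt θ₀` from `T` to `T'` is
homotopic to `ξ` (it is a reparametrisation of it). [folklore] -/
theorem loopAt_subpath_homotopic_of_lift {J : Knot} (h : Disjoint (range ⇑K) (range ⇑J))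
    (θ₀ : ℝ) {T T' : I} {x y : K.complement} (ξ : Path x y) {φ : ℝ → ℝ} (hφ : Continuous φ)
    (hmono : MonotoneOn φ (Icc 0 1)) (hlt : φ 0 < φ 1) (hφ0 : φ 0 = θ₀ + T)
    (hφ1 : φ 1 = θ₀ + T') (hval : ∀ s : I, ((ξ s : K.complement) : 𝕊 3) = J (circlePt (φ s)))
    (hx : (K.loopAt h θ₀) T = x) (hy : (K.loopAt h θ₀) T' = y) :
    ((K.loopAt h θ₀).subpath T T').Homotopic (ξ.cast hx hy) := by
  have hden : 0 < φ 1 - φ 0 := sub_pos.2 hlt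
  have hg_mem : ∀ s : I, (φ s - φ 0) / (φ 1 - φ 0) ∈ I := fun s ↦ by
    have h0 : φ 0 ≤ φ s := hmono ⟨le_rfl, zero_le_one⟩ s.2 s.2.1
    have h1 : φ s ≤ φ 1 := hmono s.2 ⟨zero_le_one, le_rfl⟩ s.2.2
    exact ⟨div_nonneg (by linarith) hden.le, (div_le_one hden).2 (by linarith)⟩
  set g : I → I := fun s ↦ ⟨(φ s - φ 0) / (φ 1 - φ 0), hg_mem s⟩ with hg
  have hgc : Continuous g := by
    refine Continuous.subtype_mk ?_ _
    exact ((hφ.comp continuous_subtype_val).sub continuous_const).div_const _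
  have hg0 : g 0 = 0 := Subtype.ext (by simp [hg])
  have hg1 : g 1 = 1 := Subtype.ext (by
    simp only [hg, Set.Icc.coe_one]
    exact div_self hden.ne')
  refine Path.Homotopic.of_reparam_eq g hgc hg0 hg1 fun s ↦ ?_
  apply Subtype.ext
  rw [Path.cast_coe, hval s, coe_loopAt_subpath_apply]
  congr 2
  simp only [hg]
  rw [hφ0, hφ1] at hden ⊢
  field_simp
  ring

/-- **A subpath of the loop of `J` which rides on another knot `J'`.** Let the arc
`r ↦ J (circlePt (θ₀ + (1 - r) T + r T'))`, `r ∈ [0, 1]`, lie on the knot `J'`, avoid the open arc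
`J' (circlePt (a', a' + τ'))` of `J'` (`0 < τ' ≤ 1`), start at `J' (circlePt (a' + τ'))` and end
at `J' (circlePt a')`. Then the subpath of `loopAt θ₀` (loop of `J`) from `T` to `T'` is homotopic
in `S³ ∖ K` to the subpath of `loopAt a'` (loop of `J'`) from `τ'` to `1`, the complementary arc
of `J'`: a lift of the first through `J'` is trapped in one translate of the window
`[a' + τ', a' + 1]` (`exists_int_window_of_avoiding`) and reparametrises the second. [folklore] -/
theorem loopAt_subpath_homotopic_of_rides {J J' : Knot} (h : Disjoint (range ⇑K) (range ⇑J))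
    (h' : Disjoint (range ⇑K) (range ⇑J')) (θ₀ a' : ℝ) {T T' : I} (τ' : I) (hτ' : 0 < (τ' : ℝ))
    (hmem : ∀ r ∈ Icc (0 : ℝ) 1, J (circlePt (θ₀ + ((1 - r) * T + r * T'))) ∈ range ⇑J')
    (havoid : ∀ r ∈ Icc (0 : ℝ) 1, ∀ t ∈ Ioo a' (a' + τ'),
      J (circlePt (θ₀ + ((1 - r) * T + r * T'))) ≠ J' (circlePt t))
    (h0 : J (circlePt (θ₀ + T)) = J' (circlePt (a' + τ')))
    (h1 : J (circlePt (θ₀ + T')) = J' (circlePt a'))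
    (hx : (K.loopAt h θ₀) T = (K.loopAt h' a') τ') (hy : (K.loopAt h θ₀) T' = (K.loopAt h' a') 1) :
    ((K.loopAt h θ₀).subpath T T').Homotopic (((K.loopAt h' a').subpath τ' 1).cast hx hy) := by
  have hτ'1 : (τ' : ℝ) ≤ 1 := τ'.2.2
  -- the arc and its lift through `J'`
  set γ : ℝ → 𝕊 3 := fun r ↦ J (circlePt (θ₀ + ((1 - r) * T + r * T'))) with hγ
  have hγc : Continuous γ := J.continuous.comp (continuous_circlePt.comp (by fun_prop))
  obtain ⟨ρ, hρc, hρ⟩ := J'.exists_lift hγc hmem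
  have hper : ∀ (t : ℝ) (m : ℤ), J' (circlePt (t - m)) = J' (circlePt t) := fun t m ↦ by
    rw [sub_eq_add_neg, ← Int.cast_neg, circlePt_add_int]
  have havoid' : ∀ r ∈ Icc (0 : ℝ) 1, ∀ m : ℤ, ρ r - m ∉ Ioo a' (a' + τ') := by
    intro r hr m hmem'
    refine havoid r hr (ρ r - m) hmem' ?_
    rw [hper, hρ r hr]
  have h0' : ∃ m : ℤ, ρ 0 = (a' + τ') + m := by
    rw [← J'.apply_circlePt_eq_iff, hρ 0 ⟨le_rfl, zero_le_one⟩, ← h0, hγ]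
    simp
  have h1' : ∃ m : ℤ, ρ 1 = a' + m := by
    rw [← J'.apply_circlePt_eq_iff, hρ 1 ⟨zero_le_one, le_rfl⟩, ← h1, hγ]
    simp
  obtain ⟨m, hwin, hρ0, hρ1⟩ := exists_int_window_of_avoiding hρc.continuousOn
    (by linarith : a' < a' + τ') (by linarith) havoid' h0' h1'
  -- values of the two paths
  have hval : ∀ (r : I), J' (circlePt (ρ r - m)) =
      J (circlePt (θ₀ + ((1 - (r : ℝ)) * T + (r : ℝ) * T'))) := fun r ↦ by
    rw [hper, hρ r r.2]
  by_cases hdeg : (τ' : ℝ) = 1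
  · -- degenerate window: both paths are constant
    refine Path.Homotopic.symm (Path.Homotopic.of_reparam_eq id continuous_id rfl rfl fun r ↦ ?_)
    apply Subtype.ext
    rw [coe_loopAt_subpath_apply, id, Path.cast_coe, coe_loopAt_subpath_apply, Set.Icc.coe_one,
      hdeg]
    have hr := hwin r r.2
    rw [hdeg] at hr
    have hρr : ρ r - m = a' + 1 := by linarith [hr.1, hr.2]
    rw [← hval r, hρr]
    congr 2
    ring
  · have hlt : (τ' : ℝ) < 1 := lt_of_le_of_ne hτ'1 hdeg
    have hden : 0 < 1 - (τ' : ℝ) := by linarith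
    have hg_mem : ∀ r : I, (ρ r - m - (a' + τ')) / (1 - τ') ∈ I := fun r ↦ by
      have hr := hwin r r.2
      exact ⟨div_nonneg (by linarith [hr.1]) hden.le, (div_le_one hden).2 (by linarith [hr.2])⟩
    set g : I → I := fun r ↦ ⟨(ρ r - m - (a' + τ')) / (1 - τ'), hg_mem r⟩ with hg
    have hgc : Continuous g := by
      refine Continuous.subtype_mk ?_ _
      exact (((hρc.comp continuous_subtype_val).sub continuous_const).sub continuous_const).div_const _
    have hg0 : g 0 = 0 := Subtype.ext (by
      simp only [hg, Set.Icc.coe_zero]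
      rw [hρ0]; ring_nf)
    have hg1 : g 1 = 1 := Subtype.ext (by
      simp only [hg, Set.Icc.coe_one]
      rw [hρ1, div_eq_one_iff_eq hden.ne']; ring)
    refine Path.Homotopic.symm (Path.Homotopic.of_reparam_eq g hgc hg0 hg1 fun r ↦ ?_)
    apply Subtype.ext
    rw [coe_loopAt_subpath_apply, Path.cast_coe, coe_loopAt_subpath_apply, Set.Icc.coe_one,
      ← hval r]
    congr 2
    simp only [hg]
    field_simp
    ring

end Knot

/-! ## More loop algebra: quotient level, casts -/

section LoopAlgebraQ

variable {X : Type*} [TopologicalSpace X] {x₀ y w : X}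

/-- `conjAb` at the level of the fundamental groupoid: the abelianised class of
`δ · q · δ⁻¹` for a class `q` of loops at `y`. [folklore] -/
def conjAbQ (δ : Path x₀ y) (q : Path.Homotopic.Quotient y y) :
    Abelianization (FundamentalGroup X x₀) :=
  Abelianization.of ((FundamentalGroup.fundamentalGroupMulEquivOfPath δ).symm
    (FundamentalGroup.fromPath q))

/-- `conjAb δ β = conjAbQ δ ⟦β⟧` (by definition). [folklore] -/
theorem conjAb_eq_conjAbQ (δ : Path x₀ y) (β : Path y y) :
    conjAb δ β = conjAbQ δ (Path.Homotopic.Quotient.mk β) := rfl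

/-- `conjAbQ` is multiplicative. [folklore] -/
theorem conjAbQ_trans (δ : Path x₀ y) (q₁ q₂ : Path.Homotopic.Quotient y y) :
    conjAbQ δ (q₁.trans q₂) = conjAbQ δ q₁ * conjAbQ δ q₂ := by
  unfold conjAbQ
  rw [show FundamentalGroup.fromPath (q₁.trans q₂) =
      FundamentalGroup.fromPath q₂ * FundamentalGroup.fromPath q₁ from rfl, map_mul, map_mul,
    mul_comm]

/-- **Re-basing `conjAbQ` along a path `ε`**: conjugating the class `q` (at `w`) by `ε : y ↝ w`
and then into `x₀` along `δ` is conjugating `q` into `x₀` along `δ · ε`. [folklore] -/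
theorem conjAbQ_conj (δ : Path x₀ y) (ε : Path y w) (q : Path.Homotopic.Quotient w w) :
    conjAbQ δ (((Path.Homotopic.Quotient.mk ε).trans q).trans
      (Path.Homotopic.Quotient.mk ε).symm) = conjAbQ (δ.trans ε) q := by
  induction q using Path.Homotopic.Quotient.ind with
  | mk β =>
    unfold conjAbQ
    rw [← Path.Homotopic.Quotient.mk_symm, ← Path.Homotopic.Quotient.mk_trans,
      ← Path.Homotopic.Quotient.mk_trans, fundamentalGroupMulEquivOfPath_symm_fromPath,
      fundamentalGroupMulEquivOfPath_symm_fromPath]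
    congr 2
    rw [Path.trans_symm]
    simp only [Path.Homotopic.Quotient.mk_trans, Path.Homotopic.Quotient.mk_symm,
      Path.Homotopic.Quotient.trans_assoc]

/-- A loop is conjugate to its cast to a propositionally equal base point. [folklore] -/
theorem LoopConj.of_cast {y' : X} (β : Path y y) (hy : y' = y) : LoopConj β (β.cast hy hy) := by
  let F : C(I × I, X) := ⟨fun q ↦ β q.2, β.continuous.comp continuous_snd⟩
  exact LoopConj.of_square F (fun _ ↦ β.source.trans β.target.symm) β (β.cast hy hy)
    (fun _ ↦ rfl) (fun _ ↦ rfl)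

end LoopAlgebraQ

/-! ## The band on the corner square: a map into `S³ ∖ K`, and the four planar paths -/

namespace BandData

variable {J₁ J₂ J : Knot} {avoid : Set (𝕊 3)} (b : BandData J₁ J₂ J avoid)

/-- **The band sends the corner square into the complement of a knot `K` missing the band
surface and the two summands** (the open square goes to the band surface, the four corners to
`J₁ ∪ J₂`). [folklore] -/
theorem band_not_mem_range_of_mem_cornerSquare {K : Knot} (hK : Disjoint (range ⇑K) b.support)
    (h₁ : Disjoint (range ⇑K) (range ⇑J₁)) (h₂ : Disjoint (range ⇑K) (range ⇑J₂)) {x : 𝔼 2}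
    (hx : x ∈ cornerSquare b.δ) : b.band x ∉ range ⇑K := by
  have hδ := b.δ_pos
  intro hxK
  rcases hx with hx | hx
  · exact Set.disjoint_left.1 hK hxK ⟨x, hx, rfl⟩
  · simp only [mem_insert_iff, mem_singleton_iff] at hx
    rcases hx with rfl | rfl | rfl | rfl
    · exact Set.disjoint_left.1 h₁ hxK (b.band_pt2_zero_mem ⟨le_rfl, by linarith⟩)
    · exact Set.disjoint_left.1 h₂ hxK (b.band_pt2_one_mem ⟨le_rfl, by linarith⟩)
    · exact Set.disjoint_left.1 h₂ hxK (b.band_pt2_one_mem ⟨by linarith, le_rfl⟩)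
    · exact Set.disjoint_left.1 h₁ hxK (b.band_pt2_zero_mem ⟨by linarith, le_rfl⟩)

/-- **The band as a continuous map from the corner square to `S³ ∖ K`.** [folklore] -/
def bandCompl {K : Knot} (hK : Disjoint (range ⇑K) b.support)
    (h₁ : Disjoint (range ⇑K) (range ⇑J₁)) (h₂ : Disjoint (range ⇑K) (range ⇑J₂)) :
    C(cornerSquare b.δ, K.complement) :=
  ⟨fun x ↦ ⟨b.band x, b.band_not_mem_range_of_mem_cornerSquare hK h₁ h₂ x.2⟩,
    Continuous.subtype_mk (b.contMDiff.continuous.comp continuous_subtype_val) _⟩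

/-- Values of `bandCompl`. [folklore] -/
@[simp] theorem coe_bandCompl_apply {K : Knot} (hK : Disjoint (range ⇑K) b.support)
    (h₁ : Disjoint (range ⇑K) (range ⇑J₁)) (h₂ : Disjoint (range ⇑K) (range ⇑J₂))
    (x : cornerSquare b.δ) : ((b.bandCompl hK h₁ h₂ x : K.complement) : 𝕊 3) = b.band x := rfl

/-- The lower-left corner `(0, -δ)` of the corner square. [folklore] -/
def cornerLL : cornerSquare b.δ := ⟨pt2 0 (-b.δ), Or.inr (by simp)⟩
/-- The lower-right corner `(1, -δ)`. [folklore] -/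
def cornerLR : cornerSquare b.δ := ⟨pt2 1 (-b.δ), Or.inr (by simp)⟩
/-- The upper-right corner `(1, 1 + δ)`. [folklore] -/
def cornerUR : cornerSquare b.δ := ⟨pt2 1 (1 + b.δ), Or.inr (by simp)⟩
/-- The upper-left corner `(0, 1 + δ)`. [folklore] -/
def cornerUL : cornerSquare b.δ := ⟨pt2 0 (1 + b.δ), Or.inr (by simp)⟩

/-- The closed lower arc lies in the corner square. [folklore] -/
theorem lowerArc_mem_cornerSquare (s : I) : b.lowerArc s ∈ cornerSquare b.δ := by
  rcases s.2.1.eq_or_lt with h0 | h0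
  · rw [← h0, b.lowerArc_zero]; exact Or.inr (by simp)
  rcases s.2.2.eq_or_lt with h1 | h1
  · rw [h1, b.lowerArc_one]; exact Or.inr (by simp)
  exact Or.inl (b.lowerArc_mem _ ⟨h0, h1⟩).1

/-- The closed upper arc lies in the corner square. [folklore] -/
theorem upperArc_mem_cornerSquare (s : I) : b.upperArc s ∈ cornerSquare b.δ := by
  rcases s.2.1.eq_or_lt with h0 | h0
  · rw [← h0, b.upperArc_zero]; exact Or.inr (by simp)
  rcases s.2.2.eq_or_lt with h1 | h1
  · rw [h1, b.upperArc_one]; exact Or.inr (by simp)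
  exact Or.inl (b.upperArc_mem _ ⟨h0, h1⟩).1

/-- The planar left edge at `0` is the lower-left corner. [folklore] -/
theorem leftEdgePlanar_zero : b.leftEdgePlanar 0 = pt2 0 (-b.δ) := by
  simp [leftEdgePlanar]

/-- The planar left edge at `1` is the upper-left corner. [folklore] -/
theorem leftEdgePlanar_one : b.leftEdgePlanar 1 = pt2 0 (1 + b.δ) := by
  simp only [leftEdgePlanar]; congr 1; ring

/-- The closed planar left edge lies in the corner square. [folklore] -/
theorem leftEdgePlanar_mem_cornerSquare (s : I) : b.leftEdgePlanar s ∈ cornerSquare b.δ := by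
  rcases s.2.1.eq_or_lt with h0 | h0
  · rw [← h0, b.leftEdgePlanar_zero]; exact Or.inr (by simp)
  rcases s.2.2.eq_or_lt with h1 | h1
  · rw [h1, b.leftEdgePlanar_one]; exact Or.inr (by simp)
  exact Or.inl (b.leftEdgePlanar_mem ⟨h0, h1⟩).1

/-- The planar right edge, traversed downwards: `s ↦ (1, 1) - leftEdgePlanar s =
(1, 1 + δ - s (1 + 2δ))`. [folklore] -/
def rightEdgePlanar (s : ℝ) : 𝔼 2 := pt2 1 1 - b.leftEdgePlanar s

/-- The planar right edge at `0` is the upper-right corner. [folklore] -/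
theorem rightEdgePlanar_zero : b.rightEdgePlanar 0 = pt2 1 (1 + b.δ) := by
  rw [rightEdgePlanar, leftEdgePlanar_zero, pt2_one_one_sub_pt2]; congr 1 <;> ring

/-- The planar right edge at `1` is the lower-right corner. [folklore] -/
theorem rightEdgePlanar_one : b.rightEdgePlanar 1 = pt2 1 (-b.δ) := by
  rw [rightEdgePlanar, leftEdgePlanar_one, pt2_one_one_sub_pt2]; congr 1 <;> ring

/-- The closed planar right edge lies in the corner square. [folklore] -/
theorem rightEdgePlanar_mem_cornerSquare (s : I) : b.rightEdgePlanar s ∈ cornerSquare b.δ := by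
  rcases s.2.1.eq_or_lt with h0 | h0
  · rw [← h0, b.rightEdgePlanar_zero]; exact Or.inr (by simp)
  rcases s.2.2.eq_or_lt with h1 | h1
  · rw [h1, b.rightEdgePlanar_one]; exact Or.inr (by simp)
  exact Or.inl (pt2_one_one_sub_mem_squareNhd_iff.2 (b.leftEdgePlanar_mem ⟨h0, h1⟩).1)

/-- The planar lower arc as a path in the corner square, from `(0, -δ)` to `(1, -δ)`.
[folklore] -/
def lowerPath : Path b.cornerLL b.cornerLR where
  toFun s := ⟨b.lowerArc s, b.lowerArc_mem_cornerSquare s⟩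
  continuous_toFun := Continuous.subtype_mk
    (b.contDiff_lowerArc.continuous.comp continuous_subtype_val) _
  source' := Subtype.ext b.lowerArc_zero
  target' := Subtype.ext b.lowerArc_one

/-- The planar upper arc as a path in the corner square, from `(1, 1 + δ)` to `(0, 1 + δ)`.
[folklore] -/
def upperPath : Path b.cornerUR b.cornerUL where
  toFun s := ⟨b.upperArc s, b.upperArc_mem_cornerSquare s⟩
  continuous_toFun := Continuous.subtype_mk
    (b.contDiff_upperArc.continuous.comp continuous_subtype_val) _
  source' := Subtype.ext b.upperArc_zero
  target' := Subtype.ext b.upperArc_one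

/-- The planar left edge as a path in the corner square, from `(0, -δ)` to `(0, 1 + δ)`.
[folklore] -/
def leftPath : Path b.cornerLL b.cornerUL where
  toFun s := ⟨b.leftEdgePlanar s, b.leftEdgePlanar_mem_cornerSquare s⟩
  continuous_toFun := Continuous.subtype_mk
    (b.contDiff_leftEdgePlanar.continuous.comp continuous_subtype_val) _
  source' := Subtype.ext b.leftEdgePlanar_zero
  target' := Subtype.ext b.leftEdgePlanar_one

/-- The planar right edge as a path in the corner square, from `(1, 1 + δ)` down to `(1, -δ)`.
[folklore] -/
def rightPath : Path b.cornerUR b.cornerLR where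
  toFun s := ⟨b.rightEdgePlanar s, b.rightEdgePlanar_mem_cornerSquare s⟩
  continuous_toFun := Continuous.subtype_mk
    ((continuous_const.sub b.contDiff_leftEdgePlanar.continuous).comp continuous_subtype_val) _
  source' := Subtype.ext b.rightEdgePlanar_zero
  target' := Subtype.ext b.rightEdgePlanar_one

/-- **The upper arc is homotopic, across the band, to right edge · lower arc⁻¹ · left edge**
(rel endpoints, in `S³ ∖ K`): the corner square is simply connected (star-shaped) and the band
maps it into `S³ ∖ K`. [folklore] -/
theorem upper_homotopic {K : Knot} (hK : Disjoint (range ⇑K) b.support)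
    (h₁ : Disjoint (range ⇑K) (range ⇑J₁)) (h₂ : Disjoint (range ⇑K) (range ⇑J₂)) :
    (b.upperPath.map (b.bandCompl hK h₁ h₂).continuous).Homotopic
      ((b.rightPath.map (b.bandCompl hK h₁ h₂).continuous).trans
        (((b.lowerPath.map (b.bandCompl hK h₁ h₂).continuous).symm).trans
          (b.leftPath.map (b.bandCompl hK h₁ h₂).continuous))) := by
  haveI : Fact (0 < b.δ) := ⟨b.δ_pos⟩
  have hplanar : b.upperPath.Homotopic (b.rightPath.trans (b.lowerPath.symm.trans b.leftPath)) :=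
    SimplyConnectedSpace.paths_homotopic _ _
  have := hplanar.map (b.bandCompl hK h₁ h₂)
  rwa [Path.map_trans, Path.map_trans, ← Path.map_symm] at this

end BandData

/-! ## The theorem -/

namespace Knot

/-- If a point of `K` in the band surface is given, it lies on one of the two open arcs
(`preimage_range`); contrapositive form used below. [folklore] -/
theorem _root_.Literature.Topology.FourManifolds.BandData.not_mem_support_of_not_mem_arcs
    {J₁ J₂ J : Knot} {avoid : Set (𝕊 3)} (b : BandData J₁ J₂ J avoid) {x : 𝕊 1}
    (hl : J x ∉ b.lowerCurve '' Ioo 0 1) (hu : J x ∉ b.upperCurve '' Ioo 0 1) :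
    J x ∉ b.support := by
  rintro ⟨q, hq, hqx⟩
  have hmem : q ∈ b.band ⁻¹' range J ∩ squareNhd b.δ := ⟨⟨x, hqx.symm⟩, hq⟩
  rw [b.preimage_range] at hmem
  rcases hmem with ⟨s, hs, rfl⟩ | ⟨s, hs, rfl⟩
  · exact hl ⟨s, hs, hqx⟩
  · exact hu ⟨s, hs, hqx⟩

/-- **The algebraic end of the proof.** If the loop of `J` is conjugate (in the fundamental
groupoid of `S³ ∖ K`) to a loop `Γ` at `y` whose class factors as
`[Γ] = (ℓ · (Q · [Γ₂] · Q⁻¹) · ℓ⁻¹) · [Γ₁]` with `Γ₁` conjugate to the loop of `J₁` and `Γ₂`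
conjugate to the loop of `J₂`, then `lk(K, J) = lk(K, J₁) + lk(K, J₂)`: conjugation is invisible
in `H₁(S³ ∖ K) = π₁ᵃᵇ` (`conjAbQ_conj`, `LoopConj.conjAb_eq`). Rolfsen (1976), §5.D.
[cite: Rolfsen1976, §5.D] -/
theorem HasLinkingNumber.add_of_loops {K J₁ J₂ J : Knot} {h₁ : Disjoint (range ⇑K) (range ⇑J₁)}
    {h₂ : Disjoint (range ⇑K) (range ⇑J₂)} {h : Disjoint (range ⇑K) (range ⇑J)} {l₁ l₂ : ℤ}
    (hl₁ : K.HasLinkingNumber J₁ h₁ l₁) (hl₂ : K.HasLinkingNumber J₂ h₂ l₂)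
    {y w y' : K.complement} (Γ Γ₁ : Path y y) (Γ₂ : Path y' y') (ℓ : Path y w) (Q : Path w y')
    (key : Path.Homotopic.Quotient.mk Γ =
      (((Path.Homotopic.Quotient.mk ℓ).trans
        (((Path.Homotopic.Quotient.mk Q).trans (Path.Homotopic.Quotient.mk Γ₂)).trans
          (Path.Homotopic.Quotient.mk Q).symm)).trans
        (Path.Homotopic.Quotient.mk ℓ).symm).trans (Path.Homotopic.Quotient.mk Γ₁))
    (LJ : LoopConj (K.loopInCompl J h) Γ) (L₁ : LoopConj Γ₁ (K.loopInCompl J₁ h₁))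
    (L₂ : LoopConj Γ₂ (K.loopInCompl J₂ h₂)) : K.HasLinkingNumber J h (l₁ + l₂) := by
  obtain ⟨ν, γ₁, E₁⟩ := hl₁
  haveI : PathConnectedSpace K.complement := Knot.pathConnectedSpace_complement_holds K
  let γ₂ : Path ν.basePoint ⟨J₂ (circlePoint 0), mem_complement_of_disjoint h₂ _⟩ :=
    PathConnectedSpace.somePath _ _
  have E₂ := (Knot.hasLinkingNumber_iff_forall_holds K J₂ h₂ l₂).1 hl₂ ν γ₂
  let γJ : Path ν.basePoint ⟨J (circlePoint 0), mem_complement_of_disjoint h _⟩ :=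
    PathConnectedSpace.somePath _ _
  let ζ : Path ν.basePoint y := PathConnectedSpace.somePath _ _
  refine ⟨ν, γJ, ?_⟩
  rw [fromPath_conj_loopInCompl] at E₁ E₂ ⊢
  change conjAb γ₁ (K.loopInCompl J₁ h₁) = _ at E₁
  change conjAb γ₂ (K.loopInCompl J₂ h₂) = _ at E₂
  change conjAb γJ (K.loopInCompl J h) = _
  rw [LJ.conjAb_eq γJ ζ, conjAb_eq_conjAbQ, key, conjAbQ_trans, conjAbQ_conj, conjAbQ_conj,
    ← conjAb_eq_conjAbQ, ← conjAb_eq_conjAbQ, L₂.conjAb_eq _ γ₂, L₁.conjAb_eq _ γ₁, E₁, E₂,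
    ← zpow_add]
  exact congrArg _ (add_comm l₂ l₁)

set_option maxHeartbeats 400000 in
/-- **Linking numbers are additive under band sums** (explicit form of the named fact
`Knot.HasLinkingNumber.bandSum` of `KirbyMovesSlideModel.lean`). Let `J` be a band sum of the
disjoint knots `J₁`, `J₂` along `b`, and `K` a knot missing `J₁`, `J₂`, `J` and the band surface,
with `lk(K, J₁) = l₁`, `lk(K, J₂) = l₂`. Then `lk(K, J) = l₁ + l₂`. Rolfsen, *Knots and Links*
(1976), §5.D (definition (2): `lk(K, J) = [J] ∈ H₁(S³ ∖ K)`); R. C. Kirby, *The Topology of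
4-Manifolds* (1989), Ch. I §4, p. 10 ("computing the new linkings"). See the module docstring
for the proof. [cite: Rolfsen1976, §5.D] -/
theorem HasLinkingNumber.bandSum_of_bandData {K J₁ J₂ J : Knot} {avoid : Set (𝕊 3)}
    (b : BandData J₁ J₂ J avoid) (hJ : Disjoint (range ⇑J₁) (range ⇑J₂))
    (hK : Disjoint (range ⇑K) b.support) (h₁ : Disjoint (range ⇑K) (range ⇑J₁))
    (h₂ : Disjoint (range ⇑K) (range ⇑J₂)) (h : Disjoint (range ⇑K) (range ⇑J)) {l₁ l₂ : ℤ}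
    (hl₁ : K.HasLinkingNumber J₁ h₁ l₁) (hl₂ : K.HasLinkingNumber J₂ h₂ l₂) :
    K.HasLinkingNumber J h (l₁ + l₂) := by
  have hδ := b.δ_pos
  have hper : ∀ (L : Knot) (t : ℝ) (m : ℤ), L (circlePt (t + m)) = L (circlePt t) :=
    fun L t m ↦ by rw [circlePt_add_int]
  /- ### the half-turned band: its left edge is the right edge of `b`, its surface that of `b` -/
  obtain ⟨b', hδ', hband'⟩ := b.exists_halfTurn hJ
  have hRval : ∀ s : ℝ, b'.leftEdge s = b.band (b.rightEdgePlanar s) := fun s ↦ by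
    rw [BandData.leftEdge_apply, hband', hδ', BandData.rightEdgePlanar, BandData.leftEdgePlanar]
  have hsupp' : b'.support = b.support := by
    change b'.band '' squareNhd b'.δ = b.band '' squareNhd b.δ
    rw [hband', hδ', show (fun x ↦ b.band (pt2 1 1 - x)) = b.band ∘ (fun x ↦ pt2 1 1 - x) from rfl,
      image_comp, image_pt2_one_one_sub_squareNhd]
  /- ### lifts of the four sides -/
  obtain ⟨φ, hφc, hφm, hφℓ⟩ := b.exists_lift_lowerCurve
  obtain ⟨χL, hχLc, hχLm, hχL⟩ := b.exists_lift_leftEdge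
  obtain ⟨χR, hχRc, hχRm, hχR⟩ := b'.exists_lift_leftEdge
  obtain ⟨ψ, hψc, hψu⟩ := J.exists_lift b.continuous_upperCurve fun s hs ↦ b.band_upperArc_mem hs
  have hℓ1 : b.lowerCurve 1 ∈ range ⇑J₂ := by
    rw [b.lowerCurve_one]; exact b.band_pt2_one_mem ⟨le_rfl, by linarith⟩
  have hu1 : b.upperCurve 1 ∈ range ⇑J₁ := by
    rw [b.upperCurve_apply, b.upperArc_one]; exact b.band_pt2_zero_mem ⟨by linarith, le_rfl⟩
  have hψm' := J.strictMonoOn_or_strictAntiOn_lift zero_lt_one hψc.continuousOn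
    (fun s hs ↦ hψu s (Ioo_subset_Icc_self hs)) b.injOn_band_upperArc
  have hψm : StrictMonoOn ψ (Ioo 0 1) :=
    J.strictMonoOn_of_lifts hφc.continuousOn hψc.continuousOn hφℓ hψu
      (hφm.mono Ioo_subset_Icc_self) hψm' b.injOn_band_lowerArc J₁.isClosed_range
      J₂.isClosed_range hJ (fun t ↦ b.apply_mem_arcs_union _) b.disjoint_image_arcs hℓ1 hu1
  have hψmI : StrictMonoOn ψ (Icc 0 1) := strictMonoOn_Icc_of_Ioo hψc.continuousOn hψm
  /- ### the windows on the parameter line of `J` -/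
  obtain ⟨k, hbc, hda, hsegB, hsegA⟩ := J.exists_windows_of_lifts hφc.continuousOn
    hψc.continuousOn hφℓ hψu (hφm.mono Ioo_subset_Icc_self) hψm b.injOn_band_lowerArc
    J₁.isClosed_range J₂.isClosed_range hJ (fun t ↦ b.apply_mem_arcs_union _)
    b.disjoint_image_arcs hℓ1 hu1
  have h01 : (0 : ℝ) ∈ Icc (0 : ℝ) 1 := ⟨le_rfl, zero_le_one⟩
  have h11 : (1 : ℝ) ∈ Icc (0 : ℝ) 1 := ⟨zero_le_one, le_rfl⟩
  have hab : φ 0 < φ 1 := hφm h01 h11 zero_lt_one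
  have hba : φ 1 ≤ φ 0 + 1 :=
    J.lift_one_le hφc.continuousOn (hφm.mono Ioo_subset_Icc_self) hφℓ b.injOn_band_lowerArc
  have hcd : ψ 0 < ψ 1 := hψmI h01 h11 zero_lt_one
  have hab₁ : χL 0 < χL 1 := hχLm h01 h11 zero_lt_one
  have hba₁ : χL 1 ≤ χL 0 + 1 :=
    J₁.lift_one_le hχLc.continuousOn (hχLm.mono Ioo_subset_Icc_self) hχL b.injOn_leftEdge
  have hab₂ : χR 0 < χR 1 := hχRm h01 h11 zero_lt_one
  have hba₂ : χR 1 ≤ χR 0 + 1 :=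
    J₂.lift_one_le hχRc.continuousOn (hχRm.mono Ioo_subset_Icc_self) hχR b'.injOn_leftEdge
  /- ### the four attaching points on the three knots -/
  have eJa : J (circlePt (φ 0)) = b.band (pt2 0 (-b.δ)) := by rw [hφℓ 0 h01, b.lowerCurve_zero]
  have eJb : J (circlePt (φ 1)) = b.band (pt2 1 (-b.δ)) := by rw [hφℓ 1 h11, b.lowerCurve_one]
  have eJc : J (circlePt (ψ 0 + k)) = b.band (pt2 1 (1 + b.δ)) := by
    rw [hper, hψu 0 h01, b.upperCurve_apply, b.upperArc_zero]
  have eJd : J (circlePt (ψ 1 + k)) = b.band (pt2 0 (1 + b.δ)) := by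
    rw [hper, hψu 1 h11, b.upperCurve_apply, b.upperArc_one]
  have eJ₁a : J₁ (circlePt (χL 0)) = b.band (pt2 0 (-b.δ)) := by rw [hχL 0 h01, b.leftEdge_zero]
  have eJ₁b : J₁ (circlePt (χL 1)) = b.band (pt2 0 (1 + b.δ)) := by rw [hχL 1 h11, b.leftEdge_one]
  have eJ₂a : J₂ (circlePt (χR 0)) = b.band (pt2 1 (1 + b.δ)) := by
    rw [hχR 0 h01, hRval, b.rightEdgePlanar_zero]
  have eJ₂b : J₂ (circlePt (χR 1)) = b.band (pt2 1 (-b.δ)) := by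
    rw [hχR 1 h11, hRval, b.rightEdgePlanar_one]
  /- ### points of `J` between the windows are off the band surface -/
  have hoffB : ∀ t ∈ Icc (φ 1) (ψ 0 + k), J (circlePt t) ∈ range ⇑J₂ ∧ J (circlePt t) ∉ b.support :=
    fun t ht ↦ ⟨(hsegB t ht).1,
      b.not_mem_support_of_not_mem_arcs (hsegB t ht).2.1 (hsegB t ht).2.2⟩
  have hoffA : ∀ t ∈ Icc (ψ 1 + k) (φ 0 + 1), J (circlePt t) ∈ range ⇑J₁ ∧ J (circlePt t) ∉ b.support :=
    fun t ht ↦ ⟨(hsegA t ht).1,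
      b.not_mem_support_of_not_mem_arcs (hsegA t ht).2.1 (hsegA t ht).2.2⟩
  /- ### the open edges lie in the band surface -/
  have hedgeL : ∀ t ∈ Ioo (χL 0) (χL 1), J₁ (circlePt t) ∈ b.support := fun t ht ↦ by
    have hm := J₁.apply_circlePt_mem_image_of_lift hχLc.continuousOn
      (hχLm.mono Ioo_subset_Icc_self) hχL ht
    have : J₁ (circlePt t) ∈ range ⇑J₁ ∩ b.support := by
      rw [b.range_left_inter_support]; exact hm
    exact this.2
  have hedgeR : ∀ t ∈ Ioo (χR 0) (χR 1), J₂ (circlePt t) ∈ b.support := fun t ht ↦ by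
    have hm := J₂.apply_circlePt_mem_image_of_lift hχRc.continuousOn
      (hχRm.mono Ioo_subset_Icc_self) hχR ht
    have : J₂ (circlePt t) ∈ range ⇑J₂ ∩ b'.support := by
      rw [b'.range_left_inter_support]; exact hm
    rw [hsupp'] at this
    exact this.2
  /- ### parameters in `[0, 1]`, the three loops, the band paths -/
  set a := φ 0 with ha
  have hT₁m : φ 1 - a ∈ I := ⟨by linarith, by linarith⟩
  have hT₂m : ψ 0 + k - a ∈ I := ⟨by linarith, by linarith [hcd]⟩
  have hT₃m : ψ 1 + k - a ∈ I := ⟨by linarith [hcd], by linarith⟩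
  set T₁ : I := ⟨φ 1 - a, hT₁m⟩ with hT₁
  set T₂ : I := ⟨ψ 0 + k - a, hT₂m⟩ with hT₂
  set T₃ : I := ⟨ψ 1 + k - a, hT₃m⟩ with hT₃
  have hτ₁m : χL 1 - χL 0 ∈ I := ⟨by linarith, by linarith⟩
  have hτ₂m : χR 1 - χR 0 ∈ I := ⟨by linarith, by linarith⟩
  set τ₁ : I := ⟨χL 1 - χL 0, hτ₁m⟩ with hτ₁
  set τ₂ : I := ⟨χR 1 - χR 0, hτ₂m⟩ with hτ₂
  set Γ := K.loopAt h a with hΓ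
  set Γ₁ := K.loopAt h₁ (χL 0) with hΓ₁
  set Γ₂ := K.loopAt h₂ (χR 0) with hΓ₂
  set B := b.bandCompl hK h₁ h₂ with hB
  set P00 : K.complement := B b.cornerLL with hP00
  set P10 : K.complement := B b.cornerLR with hP10
  set P11 : K.complement := B b.cornerUR with hP11
  set P01 : K.complement := B b.cornerUL with hP01
  set ℓ : Path P00 P10 := b.lowerPath.map B.continuous with hℓ
  set u : Path P11 P01 := b.upperPath.map B.continuous with hu
  set eL : Path P00 P01 := b.leftPath.map B.continuous with heL
  set eR : Path P11 P10 := b.rightPath.map B.continuous with heR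
  -- identification of the attaching points on the loops
  have e00 : P00 = Γ 0 := Subtype.ext (by
    rw [coe_loopAt_apply, Set.Icc.coe_zero, add_zero, eJa]; rfl)
  have e10 : P10 = Γ T₁ := Subtype.ext (by
    rw [coe_loopAt_apply, hT₁]
    change b.band (pt2 1 (-b.δ)) = J (circlePt (a + (φ 1 - a)))
    rw [add_sub_cancel, eJb])
  have e11 : P11 = Γ T₂ := Subtype.ext (by
    rw [coe_loopAt_apply, hT₂]
    change b.band (pt2 1 (1 + b.δ)) = J (circlePt (a + (ψ 0 + k - a)))
    rw [add_sub_cancel, eJc])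
  have e01 : P01 = Γ T₃ := Subtype.ext (by
    rw [coe_loopAt_apply, hT₃]
    change b.band (pt2 0 (1 + b.δ)) = J (circlePt (a + (ψ 1 + k - a)))
    rw [add_sub_cancel, eJd])
  have e00' : P00 = Γ 1 := Subtype.ext (by
    rw [coe_loopAt_apply, Set.Icc.coe_one]
    change b.band (pt2 0 (-b.δ)) = J (circlePt (a + 1))
    rw [show (a + 1 : ℝ) = a + ((1 : ℤ) : ℝ) by push_cast; ring, hper, eJa])
  have f00 : P00 = Γ₁ 0 := Subtype.ext (by
    rw [coe_loopAt_apply, Set.Icc.coe_zero, add_zero, eJ₁a]; rfl)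
  have f01 : P01 = Γ₁ τ₁ := Subtype.ext (by
    rw [coe_loopAt_apply, hτ₁]
    change b.band (pt2 0 (1 + b.δ)) = J₁ (circlePt (χL 0 + (χL 1 - χL 0)))
    rw [add_sub_cancel, eJ₁b])
  have f00' : P00 = Γ₁ 1 := Subtype.ext (by
    rw [coe_loopAt_apply, Set.Icc.coe_one]
    change b.band (pt2 0 (-b.δ)) = J₁ (circlePt (χL 0 + 1))
    rw [show (χL 0 + 1 : ℝ) = χL 0 + ((1 : ℤ) : ℝ) by push_cast; ring, hper, eJ₁a])
  have g11 : P11 = Γ₂ 0 := Subtype.ext (by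
    rw [coe_loopAt_apply, Set.Icc.coe_zero, add_zero, eJ₂a]; rfl)
  have g10 : P10 = Γ₂ τ₂ := Subtype.ext (by
    rw [coe_loopAt_apply, hτ₂]
    change b.band (pt2 1 (-b.δ)) = J₂ (circlePt (χR 0 + (χR 1 - χR 0)))
    rw [add_sub_cancel, eJ₂b])
  have g11' : P11 = Γ₂ 1 := Subtype.ext (by
    rw [coe_loopAt_apply, Set.Icc.coe_one]
    change b.band (pt2 1 (1 + b.δ)) = J₂ (circlePt (χR 0 + 1))
    rw [show (χR 0 + 1 : ℝ) = χR 0 + ((1 : ℤ) : ℝ) by push_cast; ring, hper, eJ₂a])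
  /- ### H1: the first window of `J` is the lower arc -/
  have H1 : (Γ.subpath 0 T₁).Homotopic (ℓ.cast e00.symm e10.symm) :=
    K.loopAt_subpath_homotopic_of_lift h a ℓ hφc hφm.monotoneOn hab
      (by rw [Set.Icc.coe_zero, add_zero]) (by rw [hT₁]; change φ 1 = a + (φ 1 - a); ring)
      (fun s' ↦ (hφℓ s' s'.2).symm) e00.symm e10.symm
  /- ### H3: the third window of `J` is the upper arc -/
  have H3 : (Γ.subpath T₂ T₃).Homotopic (u.cast e11.symm e01.symm) :=
    K.loopAt_subpath_homotopic_of_lift h a u (φ := fun s' ↦ ψ s' + k)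
      (hψc.add continuous_const) (fun x hx y hy hxy ↦ by
        simpa using (hψmI.monotoneOn hx hy hxy)) (by simpa using hcd)
      (by rw [hT₂]; change ψ 0 + k = a + (ψ 0 + k - a); ring)
      (by rw [hT₃]; change ψ 1 + k = a + (ψ 1 + k - a); ring)
      (fun s' ↦ by rw [hper]; exact (hψu s' s'.2).symm) e11.symm e01.symm
  /- ### H5: the edges as first windows of `J₁`, `J₂` -/
  have H5L : (Γ₁.subpath 0 τ₁).Homotopic (eL.cast f00.symm f01.symm) :=
    K.loopAt_subpath_homotopic_of_lift h₁ (χL 0) eL hχLc hχLm.monotoneOn hab₁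
      (by rw [Set.Icc.coe_zero, add_zero]) (by rw [hτ₁]; change χL 1 = χL 0 + (χL 1 - χL 0); ring)
      (fun s' ↦ (hχL s' s'.2).symm) f00.symm f01.symm
  have H5R : (Γ₂.subpath 0 τ₂).Homotopic (eR.cast g11.symm g10.symm) :=
    K.loopAt_subpath_homotopic_of_lift h₂ (χR 0) eR hχRc hχRm.monotoneOn hab₂
      (by rw [Set.Icc.coe_zero, add_zero]) (by rw [hτ₂]; change χR 1 = χR 0 + (χR 1 - χR 0); ring)
      (fun s' ↦ by
        change b.band (b.rightEdgePlanar s') = _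
        rw [← hRval]; exact (hχR s' s'.2).symm) g11.symm g10.symm
  /- ### H2: the second window of `J` is the complementary arc of `J₂` -/
  have H2 : (Γ.subpath T₁ T₂).Homotopic ((Γ₂.subpath τ₂ 1).cast (e10.symm.trans g10)
      (e11.symm.trans g11')) := by
    have hwin : ∀ r ∈ Icc (0 : ℝ) 1,
        a + ((1 - r) * (T₁ : ℝ) + r * (T₂ : ℝ)) ∈ Icc (φ 1) (ψ 0 + k) := by
      intro r hr
      rw [hT₁, hT₂]
      change a + ((1 - r) * (φ 1 - a) + r * (ψ 0 + k - a)) ∈ Icc (φ 1) (ψ 0 + k)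
      constructor <;> nlinarith [hr.1, hr.2, hbc]
    refine K.loopAt_subpath_homotopic_of_rides h h₂ a (χR 0) τ₂ (by rw [hτ₂]; exact sub_pos.2 hab₂)
      (fun r hr ↦ (hoffB _ (hwin r hr)).1) (fun r hr t ht e ↦ (hoffB _ (hwin r hr)).2 ?_) ?_ ?_ _ _
    · rw [e]
      refine hedgeR t ?_
      rwa [hτ₂, show χR 0 + (χR 1 - χR 0 : ℝ) = χR 1 by ring] at ht
    · rw [hT₁, hτ₂]
      change J (circlePt (a + (φ 1 - a))) = J₂ (circlePt (χR 0 + (χR 1 - χR 0)))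
      rw [add_sub_cancel, add_sub_cancel, eJb, eJ₂b]
    · rw [hT₂]
      change J (circlePt (a + (ψ 0 + k - a))) = J₂ (circlePt (χR 0))
      rw [add_sub_cancel, eJc, eJ₂a]
  /- ### H4: the fourth window of `J` is the complementary arc of `J₁` -/
  have H4 : (Γ.subpath T₃ 1).Homotopic ((Γ₁.subpath τ₁ 1).cast (e01.symm.trans f01)
      (e00'.symm.trans f00')) := by
    have hwin : ∀ r ∈ Icc (0 : ℝ) 1,
        a + ((1 - r) * (T₃ : ℝ) + r * ((1 : I) : ℝ)) ∈ Icc (ψ 1 + k) (φ 0 + 1) := by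
      intro r hr
      rw [hT₃, Set.Icc.coe_one]
      change a + ((1 - r) * (ψ 1 + k - a) + r * 1) ∈ Icc (ψ 1 + k) (φ 0 + 1)
      constructor <;> nlinarith [hr.1, hr.2, hda]
    refine K.loopAt_subpath_homotopic_of_rides h h₁ a (χL 0) τ₁ (by rw [hτ₁]; exact sub_pos.2 hab₁)
      (fun r hr ↦ (hoffA _ (hwin r hr)).1) (fun r hr t ht e ↦ (hoffA _ (hwin r hr)).2 ?_) ?_ ?_ _ _
    · rw [e]
      refine hedgeL t ?_
      rwa [hτ₁, show χL 0 + (χL 1 - χL 0 : ℝ) = χL 1 by ring] at ht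
    · rw [hT₃, hτ₁]
      change J (circlePt (a + (ψ 1 + k - a))) = J₁ (circlePt (χL 0 + (χL 1 - χL 0)))
      rw [add_sub_cancel, add_sub_cancel, eJd, eJ₁b]
    · rw [Set.Icc.coe_one]
      change J (circlePt (a + 1)) = J₁ (circlePt (χL 0))
      rw [show (a + 1 : ℝ) = a + ((1 : ℤ) : ℝ) by push_cast; ring, hper, eJa, eJ₁a]
  /- ### H7: across the band, `u ≃ eR · ℓ⁻¹ · eL` -/
  have H7 : u.Homotopic (eR.trans (ℓ.symm.trans eL)) := b.upper_homotopic hK h₁ h₂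
  /- ### everything at the canonical corners -/
  set s01 : Path P00 P10 := (Γ.subpath 0 T₁).cast e00 e10 with hs01
  set s12 : Path P10 P11 := (Γ.subpath T₁ T₂).cast e10 e11 with hs12
  set s23 : Path P11 P01 := (Γ.subpath T₂ T₃).cast e11 e01 with hs23
  set s31 : Path P01 P00 := (Γ.subpath T₃ 1).cast e01 e00' with hs31
  set Q2c : Path P10 P11 := (Γ₂.subpath τ₂ 1).cast g10 g11' with hQ2c
  set Q4c : Path P01 P00 := (Γ₁.subpath τ₁ 1).cast f01 f00' with hQ4c
  set EL : Path P00 P01 := (Γ₁.subpath 0 τ₁).cast f00 f01 with hEL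
  set ER : Path P11 P10 := (Γ₂.subpath 0 τ₂).cast g11 g10 with hER
  set Γc : Path P00 P00 := Γ.cast (e00.trans Γ.source) (e00.trans Γ.source) with hΓc
  set Γ₁c : Path P00 P00 := Γ₁.cast (f00.trans Γ₁.source) (f00.trans Γ₁.source) with hΓ₁c
  set Γ₂c : Path P11 P11 := Γ₂.cast (g11.trans Γ₂.source) (g11.trans Γ₂.source) with hΓ₂c
  have HΓ : (((s01.trans s12).trans s23).trans s31).Homotopic Γc := by
    have h0 := (Path.Homotopic.subpath_four Γ T₁ T₂ T₃).pathCast e00 e00'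
    have e1 : ((((Γ.subpath 0 T₁).trans (Γ.subpath T₁ T₂)).trans (Γ.subpath T₂ T₃)).trans
        (Γ.subpath T₃ 1)).cast e00 e00' = ((s01.trans s12).trans s23).trans s31 := by
      ext t; rfl
    have e2 : (Γ.cast Γ.source Γ.target).cast e00 e00' = Γc := by ext t; rfl
    rwa [e1, e2] at h0
  have HΓ₁ : (EL.trans Q4c).Homotopic Γ₁c := by
    have h0 := (Path.Homotopic.subpath_two Γ₁ τ₁).pathCast f00 f00'
    have e1 : ((Γ₁.subpath 0 τ₁).trans (Γ₁.subpath τ₁ 1)).cast f00 f00' = EL.trans Q4c := by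
      ext t; rfl
    have e2 : (Γ₁.cast Γ₁.source Γ₁.target).cast f00 f00' = Γ₁c := by ext t; rfl
    rwa [e1, e2] at h0
  have HΓ₂ : (ER.trans Q2c).Homotopic Γ₂c := by
    have h0 := (Path.Homotopic.subpath_two Γ₂ τ₂).pathCast g11 g11'
    have e1 : ((Γ₂.subpath 0 τ₂).trans (Γ₂.subpath τ₂ 1)).cast g11 g11' = ER.trans Q2c := by
      ext t; rfl
    have e2 : (Γ₂.cast Γ₂.source Γ₂.target).cast g11 g11' = Γ₂c := by ext t; rfl
    rwa [e1, e2] at h0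
  have H1c : s01.Homotopic ℓ := by
    have h0 := H1.pathCast e00 e10
    have e2 : (ℓ.cast e00.symm e10.symm).cast e00 e10 = ℓ := by ext t; rfl
    rwa [e2] at h0
  have H2c : s12.Homotopic Q2c := by
    have h0 := H2.pathCast e10 e11
    have e2 : ((Γ₂.subpath τ₂ 1).cast (e10.symm.trans g10) (e11.symm.trans g11')).cast e10 e11 =
        Q2c := by ext t; rfl
    rwa [e2] at h0
  have H3c : s23.Homotopic u := by
    have h0 := H3.pathCast e11 e01
    have e2 : (u.cast e11.symm e01.symm).cast e11 e01 = u := by ext t; rfl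
    rwa [e2] at h0
  have H4c : s31.Homotopic Q4c := by
    have h0 := H4.pathCast e01 e00'
    have e2 : ((Γ₁.subpath τ₁ 1).cast (e01.symm.trans f01) (e00'.symm.trans f00')).cast e01 e00' =
        Q4c := by ext t; rfl
    rwa [e2] at h0
  have H5Lc : EL.Homotopic eL := by
    have h0 := H5L.pathCast f00 f01
    have e2 : (eL.cast f00.symm f01.symm).cast f00 f01 = eL := by ext t; rfl
    rwa [e2] at h0
  have H5Rc : ER.Homotopic eR := by
    have h0 := H5R.pathCast g11 g10
    have e2 : (eR.cast g11.symm g10.symm).cast g11 g10 = eR := by ext t; rfl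
    rwa [e2] at h0
  /- ### in the fundamental groupoid of `S³ ∖ K` -/
  have qΓ : Path.Homotopic.Quotient.mk Γc =
      (((Path.Homotopic.Quotient.mk ℓ).trans (Path.Homotopic.Quotient.mk Q2c)).trans
        (Path.Homotopic.Quotient.mk u)).trans (Path.Homotopic.Quotient.mk Q4c) := by
    rw [← Path.Homotopic.Quotient.eq.2 HΓ, ← Path.Homotopic.Quotient.eq.2 H1c,
      ← Path.Homotopic.Quotient.eq.2 H2c, ← Path.Homotopic.Quotient.eq.2 H3c,
      ← Path.Homotopic.Quotient.eq.2 H4c]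
    simp only [Path.Homotopic.Quotient.mk_trans]
  have qu : Path.Homotopic.Quotient.mk u = (Path.Homotopic.Quotient.mk eR).trans
      ((Path.Homotopic.Quotient.mk ℓ).symm.trans (Path.Homotopic.Quotient.mk eL)) := by
    rw [Path.Homotopic.Quotient.eq.2 H7]
    simp only [Path.Homotopic.Quotient.mk_trans, Path.Homotopic.Quotient.mk_symm]
  have qΓ₁ : Path.Homotopic.Quotient.mk Γ₁c =
      (Path.Homotopic.Quotient.mk eL).trans (Path.Homotopic.Quotient.mk Q4c) := by
    rw [← Path.Homotopic.Quotient.eq.2 HΓ₁, ← Path.Homotopic.Quotient.eq.2 H5Lc,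
      Path.Homotopic.Quotient.mk_trans]
  have qΓ₂ : Path.Homotopic.Quotient.mk Γ₂c =
      (Path.Homotopic.Quotient.mk eR).trans (Path.Homotopic.Quotient.mk Q2c) := by
    rw [← Path.Homotopic.Quotient.eq.2 HΓ₂, ← Path.Homotopic.Quotient.eq.2 H5Rc,
      Path.Homotopic.Quotient.mk_trans]
  -- `[Γ] = (ℓ · (Q₂ · [Γ₂] · Q₂⁻¹) · ℓ⁻¹) · [Γ₁]`
  have key : Path.Homotopic.Quotient.mk Γc =
      (((Path.Homotopic.Quotient.mk ℓ).trans
        (((Path.Homotopic.Quotient.mk Q2c).trans (Path.Homotopic.Quotient.mk Γ₂c)).trans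
          (Path.Homotopic.Quotient.mk Q2c).symm)).trans
        (Path.Homotopic.Quotient.mk ℓ).symm).trans (Path.Homotopic.Quotient.mk Γ₁c) := by
    rw [qΓ, qu, qΓ₁, qΓ₂]
    simp only [Path.Homotopic.Quotient.trans_assoc,
      Literature.AlgebraicTopology.FundamentalGroup.VanKampen.trans_symm_cancel]
  /- ### linking numbers -/
  exact HasLinkingNumber.add_of_loops hl₁ hl₂ Γc Γ₁c Γ₂c ℓ Q2c key
    ((K.loopConj_loopInCompl_loopAt h a).trans (LoopConj.of_cast Γ (e00.trans Γ.source)))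
    ((K.loopConj_loopInCompl_loopAt h₁ (χL 0)).trans
      (LoopConj.of_cast Γ₁ (f00.trans Γ₁.source))).symm
    ((K.loopConj_loopInCompl_loopAt h₂ (χR 0)).trans
      (LoopConj.of_cast Γ₂ (g11.trans Γ₂.source))).symm

/-- **Discharge of the named fact (S₂) `Knot.HasLinkingNumber.bandSum`** of
`KirbyMovesSlideModel.lean` (linking numbers are additive under band sums: Rolfsen, *Knots and
Links* (1976), §5.D; the bilinearity behind the framing of a handle slide, Kirby (1989), Ch. I
§4, p. 10), by `HasLinkingNumber.bandSum_of_bandData`. [cite: Rolfsen1976, §5.D] -/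
theorem HasLinkingNumber.bandSum_holds : HasLinkingNumber.bandSum :=
  fun b hJ hK h₁ h₂ h _ _ hl₁ hl₂ ↦ HasLinkingNumber.bandSum_of_bandData b hJ hK h₁ h₂ h hl₁ hl₂

end Knot

end Literature.Topology.FourManifolds
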